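import Literature.NumberTheory.EllipticCurves.ComplexMultiplicationBurungaleFlachFiniteProofs
import Literature.NumberTheory.EllipticCurves.ComplexMultiplicationSingularModuliProofs
import Literature.NumberTheory.EllipticCurves.ComplexMultiplicationTwistIsogenyCertProofs
import Literature.NumberTheory.EllipticCurves.ComplexMultiplicationDeuringArtinProofs
import Literature.NumberTheory.EllipticCurves.ComplexMultiplicationLFunctionIsogenyProofs
import Literature.NumberTheory.EllipticCurves.ComplexMultiplicationShaHeckeProofs
import HarnessLib

/-!
# bsd.S28 (Burungale–Flach): Corollary 1 over the CM field from its current terminal leaves,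
with the Deuring–Hecke continuation in place of modularity

Proof sibling of `ComplexMultiplicationBurungaleFlachDescent.lean` for its named fact
`Literature.NumberTheory.EllipticCurves.BurungaleFlach2024_bsd_cmField` — Burungale–Flach,
Camb. J. Math. 12 (2024), **Corollary 1** ("BSD for `E/F`") at `F = K` for the base change `E_K`
of a CM curve `E/ℚ` with `j(E) ∈ maximalCMJInvariants` and `L(E/ℚ,1) ≠ 0`: `E(K)`, `Ш(E/K)`
finite and `L(E/K,1)/Ω(E) = |Ш(E/K)| / |E(K)|² · ∏_v |Φ_v|`. It adds no mathematics beyond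
bookkeeping; it records in single theorems **exactly which named facts Corollary 1 over `K` rests
on today**, after the discharges that have landed since the level-3/4 files were written
(`ComplexMultiplicationBurungaleFlachCorOneProofs`, `…PrimaryProofs`, `…FiniteProofs`,
`…AssemblyProofs`):

* the CM period lattice `Λ_E = Ω·𝓞_K` is a theorem
  (`exists_isCMPeriod_of_j_mem_maximalCMJInvariants_holds`, all nine singular moduli of Cox's
  table (12.20) being proved, `ComplexMultiplicationSingularModuliProofs`);
* the `ℚ`-isogeny `E ∼ E^{(d_K)}` of a maximal-order CM curve with its twist by the CM character
  is a theorem (`isIsogenous_quadraticTwist_cmFieldDiscr_holds`, six certified cyclic isogenies,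
  `ComplexMultiplicationTwistIsogenyCertProofs`);

and with one weakening of a leaf, in the spirit of `ComplexMultiplicationShaHeckeProofs.lean`:
modularity (`WeierstrassCurve.hasEntireLFunction_rat`: *every* `E/ℚ` has an entire `L`-function)
enters the printed proof of Corollary 1 at one point only — to know that `L(E/ℚ,s)` has an entire
continuation for the CM curve `E` itself, so that `L(E_K/K,1) = L(E/ℚ,1)²`
(`entireLFunction_one_eq_sq_of_LFunction_eq_mul_self`) — and for CM curves that continuation is
Deuring's theorem with Hecke's continuation of `L(s,ψ)` (Silverman, *Advanced Topics*,
Cor. II.10.5.1), already vendored as the named fact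
`Literature.NumberTheory.EllipticCurves.hasEntireLFunction_of_j_mem_maximalCMJInvariants` (a
special case of the modularity leaf, `…_of_hasEntireLFunction_rat`). This is also what the paper
uses (proof of Cor. 1: *"the identity [Shimura, Thm. 7.42] `L(E/F,s) = L(ψ̄,s)L(ψ,s)`"*, Hecke
`L`-functions, entire).

* `BurungaleFlach2024_bsd_cmField_of_main_of_hecke` (**proved**): Corollary 1 at `F = K` from
  Theorem 1.1 at `F = K` (`BurungaleFlach2024_main_cmField`), Deuring's
  `L(E_K/K,s) = L(E/ℚ,s)²` and the CM continuation — the level-3 assembly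
  `BurungaleFlach2024_bsd_cmField_of_main` with its period input discharged and `hmod` weakened;
* `BurungaleFlach2024_finite_primary_cmField_of_classical_of_hecke` (**proved**): the finiteness
  half of Theorem 1.1 (Prop. 4.1 at `F = K`) from Coates–Wiles finiteness over `ℚ`, Knapp 11.67,
  Rubin 1987 §10, Deuring and the CM continuation — `…_of_classical` with the twist isogeny
  discharged and `hmod` weakened;
* `BurungaleFlach2024_bsd_cmField_of_printed_leaves` (**proved**): Corollary 1 over `K` from the
  four printed inputs of its proof in the paper — Prop. 4.1 (`BurungaleFlach2024_finite_primary_cmField`),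
  Prop. 2.3 with Lemma 13 (`BurungaleFlach2024_main_cmField_pPart`), Deuring/Shimura
  (`Deuring_LFunction_baseChange_cmField`) and the Hecke continuation;
* `BurungaleFlach2024_bsd_cmField_of_classical_leaves` (**proved**): Corollary 1 over `K` from
  the six terminal leaves of the tree — Prop. 2.3 with Lemma 13 at `F = K` (the paper's own
  contribution), Rubin 1987 §10 (`Rubin1987_sha_primary_finite`), Coates–Wiles 1977 §6
  (`CoatesWiles1977_L_one_div_period_mem_prime`), Artin formalism for `E_K`
  (`LSeries_baseChange_quadratic`), the Euler factors of the Tate module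
  (`hasseWeilEulerFactor_geomPoints`, whence Knapp 11.67) and the CM continuation — everything
  else (Mordell–Weil, nine singular moduli, nine twist isogenies, class number one, global minimal
  models, the period dictionary (periodnorm), the quadratic descent of finiteness, the local–global
  passage for fractional ideals, Thm. 1.1 ⇒ Cor. 1) being theorems of the tree;
* `BurungaleFlach2024_bsd_cmField_of_classical_leaves_of_modularity` (bookkeeping): the same
  with the modularity leaf, i.e. the shape of
  `bsdTriple_of_j_mem_maximalCMJInvariants_of_L_one_ne_zero_of_eleven_leaves` restricted to
  Corollary 1.

## References

* A. Burungale, M. Flach, *The conjecture of Birch and Swinnerton-Dyer for certain elliptic curves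
  with complex multiplication*, Camb. J. Math. 12 (2024), no. 2 (arXiv:2206.09874): Thm. 1.1,
  Remark 1, Cor. 1 and its proof (p. 3), p. 4 (first two sentences), Remark 2, Prop. 2.3 (p. 12),
  Prop. 4.1 and Remark 10 (p. 19), Lemma 13 and the proof of Thm. 1.1 (p. 22). [BurungaleFlach2024]
* J. H. Silverman, *Advanced Topics in the Arithmetic of Elliptic Curves*, GTM 151 (1994), Ch. II
  Thm. 10.5 and Cor. 10.5.1 (Deuring; Hecke). [SilvermanATAEC1994]
* K. Rubin, Invent. Math. 89 (1987), §10. [Rubin1987Sha]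
* J. Coates, A. Wiles, Invent. Math. 39 (1977), Thm. 1, §1 p. 225, §6. [CoatesWiles1977]
-/

noncomputable section

open scoped Classical ComplexConjugate

open Complex NumberField WeierstrassCurve

namespace Literature.NumberTheory.EllipticCurves

/-! ### Corollary 1 from Theorem 1.1 with the Deuring–Hecke continuation -/

/-- **Corollary 1 at `F = K` from Theorem 1.1, by the printed proof, with the CM continuation in
place of modularity** (Burungale–Flach 2024, proof of Cor. 1, arXiv p. 3; the level-3 assembly
`BurungaleFlach2024_bsd_cmField_of_main` rerun). Given Theorem 1.1 with Remark 1 over `K` (`hT`),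
Deuring's `L(E_K/K,s) = L(E/ℚ,s)²` (`hD`, the Grössencharacter-free form of Shimura's
`L(E/F,s) = L(ψ̄,s)L(ψ,s)`) and the entire continuation of `L(E/ℚ,s)` for CM curves (`hH`,
Deuring–Hecke, Silverman *Advanced Topics* Cor. II.10.5.1): for `W, K, W'` as in the leaf, take the
infinite place `w` of `K`, `σ = σ_w`, and the period data of `W'` along `σ` (`Λ = Ω·𝓞_K`, from
the proved CM period lattice `exists_isCMPeriod_of_j_mem_maximalCMJInvariants_holds` through
`exists_periodPair_of_smul_baseChange`); Theorem 1.1 gives finiteness and `z ∈ K`, `v ∈ 𝓞_K^×`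
with `σz · Ω = L(E/ℚ,1)`, `z² #E(K)² = v · #Ш · ∏ c_v`; then `L(E_K/K,1) = L(E/ℚ,1)²` with
`L(E/ℚ,1)` real (`conj_entireLFunction_ofReal`), `Ω(E_K) = |Ω|²` ((periodnorm),
`bsdPeriod_eq_norm_sq_of_coe_lattice_eq`) and `|σ v| = 1` (`norm_embedding_unit_eq_one`,
`N_{K/ℚ}`), whence `L(E_K/K,1)/Ω(E_K) = |σz|² = #Ш ∏ c_v / #E(K)²`.
[cite: BurungaleFlach2024, Cor. 1 and its proof (arXiv p. 3)]
[cite: SilvermanATAEC1994, Ch. II Cor. 10.5.1 (PDF p. 171)] -/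
theorem BurungaleFlach2024_bsd_cmField_of_main_of_hecke (hT : BurungaleFlach2024_main_cmField)
    (hD : Deuring_LFunction_baseChange_cmField)
    (hH : hasEntireLFunction_of_j_mem_maximalCMJInvariants) : BurungaleFlach2024_bsd_cmField := by
  intro W _ hj hL K _ _ hK W' _ _ hW'
  -- the infinite place and the embedding
  obtain ⟨w⟩ : Nonempty (InfinitePlace K) := inferInstance
  set σ : K →+* ℂ := w.embedding with hσ
  -- the period data of `W'` along `σ`: `Λ = Ω · 𝓞_K` (singular moduli, proved)
  obtain ⟨L, Ω, h₂, h₃, hLΩ⟩ := exists_periodPair_of_smul_baseChange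
    exists_isCMPeriod_of_j_mem_maximalCMJInvariants_holds W hj W' hW' σ
  -- Theorem 1.1 over `K`
  obtain ⟨hfin, hsha, z, v, hz, hzv⟩ := hT W hj hL K hK W' hW' σ L Ω h₂ h₃ hLΩ
  refine ⟨hfin, hsha, ?_⟩
  -- (periodnorm): `Ω(E_K) = |Ω|²`
  have hΩ : W'.bsdPeriod = ‖Ω‖ ^ 2 := bsdPeriod_eq_norm_sq_of_coe_lattice_eq hj hK W' w h₂ h₃ hLΩ
  have hΩ0 : Ω ≠ 0 := ne_zero_of_coe_lattice_eq_image L hLΩ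
  -- Shimura / Deuring with the Hecke continuation: `L(E_K/K, 1) = L(E/ℚ,1)² = |L(E/ℚ,1)|²`
  obtain ⟨C, rfl⟩ := hW'
  haveI : (W.baseChange K).IsElliptic := by rw [baseChange]; infer_instance
  have hLK : (C • W.baseChange K).entireLFunction 1 = W.entireLFunction 1 ^ 2 := by
    rw [entireLFunction_smul]
    exact entireLFunction_one_eq_sq_of_LFunction_eq_mul_self (hH W hj) (hD W hj K hK)
  have hreal : conj (W.entireLFunction 1) = W.entireLFunction 1 := by
    have := W.conj_entireLFunction_ofReal (hH W hj) 1
    rwa [Complex.ofReal_one] at this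
  -- `N_{K/ℚ}`: units have absolute value `1`
  have hv : ‖σ ((v : 𝓞 K) : K)‖ = 1 :=
    norm_embedding_unit_eq_one (hK.card_infinitePlace hj) σ v
  -- `E(K)` is finite and nonempty
  haveI := hfin
  have hcard : Nat.card (C • W.baseChange K).toAffine.Point ≠ 0 := Nat.card_pos.ne'
  -- the ideal identity under `σ`
  have hzv' : (σ z) ^ 2 * (Nat.card (C • W.baseChange K).toAffine.Point : ℂ) ^ 2 =
      σ ((v : 𝓞 K) : K) * ((C • W.baseChange K).shaOrder : ℂ) *
        ((C • W.baseChange K).tamagawaProduct : ℂ) := by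
    have := congrArg σ hzv
    simpa using this
  rw [hLK, hΩ]
  exact sq_div_norm_sq_eq_of_norm_eq (W.entireLFunction 1) _ (σ z) _ _ _ _ hcard hΩ0 hz hreal hv
    hzv'

/-! ### The finiteness half (Prop. 4.1) from its classical sources, with the CM continuation -/

/-- **The finiteness half of Theorem 1.1 at `F = K` from Coates–Wiles 1977 and Rubin 1987, with
the CM continuation in place of modularity** (Burungale–Flach, Remark 10: *"the finiteness of the
Mordell–Weil group is due to Coates and Wiles, Arthaud and Rubin. For `L = K` the finiteness of
the Tate–Shafarevich group is due to Rubin [rubin87]"*; the assembly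
`BurungaleFlach2024_finite_primary_cmField_of_classical` rerun). For every rational prime `p`:
`E(ℚ)` is finite (`hF1`, Coates–Wiles Thm. 1 with Mordell–Weil), and so is `E^{(d_K)}(ℚ)` (same
`j`, and `L(E^{(d_K)},1) = L(E,1) ≠ 0` by the proved `ℚ`-isogeny `E ∼ E^{(d_K)}`,
`isIsogenous_quadraticTwist_cmFieldDiscr_holds`, and Knapp 11.67 `hKn`), hence `E(K)` is finite
(`finite_point_baseChange_of_finite_of_finite_quadraticTwist`) and so is `W'(K) ≅ E(K)`; and
`Ш(E_K/K)[p^∞]` is finite by Rubin 1987 §10 (`hR`), whose hypothesis `L(E_K/K,1) ≠ 0` is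
`L(E/ℚ,1)² ≠ 0` by Deuring (`hD`) and the continuation (`hH`), transported to `W'`
(`finite_sha_primary_variableChange_iff`).
[cite: BurungaleFlach2024, Prop. 4.1 with Remark 10 (arXiv p. 19)]
[cite: CoatesWiles1977, Thm 1 (p. 223)] [cite: Rubin1987Sha, §10, proof of Thm. A, p. 549]
[cite: SilvermanATAEC1994, Ch. II Cor. 10.5.1 (PDF p. 171)] -/
theorem BurungaleFlach2024_finite_primary_cmField_of_classical_of_hecke
    (hF1 : finite_point_of_j_mem_maximalCMJInvariants_of_L_one_ne_zero)
    (hKn : LFunction_eq_of_isIsogenous) (hR : Rubin1987_sha_primary_finite)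
    (hD : Deuring_LFunction_baseChange_cmField)
    (hH : hasEntireLFunction_of_j_mem_maximalCMJInvariants) :
    BurungaleFlach2024_finite_primary_cmField := by
  intro W _ hj hL K _ _ hK W' _ _ hW' p hp
  obtain ⟨C, rfl⟩ := hW'
  -- the square-root generator of the CM field: `θ² = d_K`, `θ ∉ ℚ`
  obtain ⟨θ, hθ⟩ := hK.2
  have hd : cmFieldDiscr W.j < 0 := cmFieldDiscr_neg hj
  have hθ' : θ ∉ Set.range (algebraMap ℚ K) := by
    rintro ⟨q, hq⟩
    have h1 : (algebraMap ℚ K) (q ^ 2) = (algebraMap ℚ K) (cmFieldDiscr W.j : ℚ) := by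
      rw [map_pow, hq, hθ, map_intCast]
    have h2 : q ^ 2 = (cmFieldDiscr W.j : ℚ) := (algebraMap ℚ K).injective h1
    have h3 : (0 : ℚ) ≤ q ^ 2 := sq_nonneg q
    have h4 : ((cmFieldDiscr W.j : ℤ) : ℚ) < 0 := by exact_mod_cast hd
    linarith
  have hc : θ ^ 2 = algebraMap ℚ K (cmFieldDiscr W.j : ℚ) := by rw [hθ, map_intCast]
  have hd0 : (cmFieldDiscr W.j : ℚ) ≠ 0 := by exact_mod_cast hd.ne
  -- `E(ℚ)` and `E^{(d_K)}(ℚ)` are finite (Coates–Wiles, for `E` and for its twist)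
  have hfinQ : Finite W.toAffine.Point := hF1 W hj hL
  haveI : (W.quadraticTwist (cmFieldDiscr W.j : ℚ)).IsElliptic := W.isElliptic_quadraticTwist hd0
  have hjd : (W.quadraticTwist (cmFieldDiscr W.j : ℚ)).j ∈ maximalCMJInvariants := by
    rw [W.j_quadraticTwist hd0]
    exact hj
  have hLd : (W.quadraticTwist (cmFieldDiscr W.j : ℚ)).entireLFunction 1 ≠ 0 := by
    rw [← entireLFunction_eq_of_isIsogenous hKn (isIsogenous_quadraticTwist_cmFieldDiscr_holds W hj)]
    exact hL
  have hfinQd : Finite (W.quadraticTwist (cmFieldDiscr W.j : ℚ)).toAffine.Point :=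
    hF1 (W.quadraticTwist (cmFieldDiscr W.j : ℚ)) hjd hLd
  -- hence `E(K)` is finite, and so is `W'(K) ≅ E(K)`
  have hfinK : Finite (W.baseChange K).toAffine.Point :=
    W.finite_point_baseChange_of_finite_of_finite_quadraticTwist hK.1 hθ' hc hfinQ hfinQd
  have hfinW' : Finite (C • W.baseChange K).toAffine.Point :=
    Finite.of_equiv _ (VariableChange.pointEquiv (W.baseChange K) C).toEquiv
  -- `L(E_K/K, 1) = L(E/ℚ, 1)² ≠ 0`, so Rubin 1987 §10 applies to `E_K`
  have hLK : (W.baseChange K).entireLFunction 1 ≠ 0 := by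
    rw [entireLFunction_one_eq_sq_of_LFunction_eq_mul_self (hH W hj) (hD W hj K hK)]
    exact pow_ne_zero 2 hL
  have hprim : Set.Finite {c : (W.baseChange K).sha | ∃ j : ℕ, p ^ j • c = 0} :=
    hR W hj K hK hLK p hp
  exact ⟨hfinW', ((W.baseChange K).finite_sha_primary_variableChange_iff C p).mpr hprim⟩

/-! ### Corollary 1 over `K` from its current leaves -/

/-- **Corollary 1 at `F = K` from the four printed inputs of its proof in the paper.**
`BurungaleFlach2024_bsd_cmField` follows, sorry-free, from: Prop. 4.1 at `F = K` (`hA`: `E(K)`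
and `Ш(E/K)[p^∞]` finite for all `p`), Prop. 2.3 with Lemma 13 at `F = K` (`hB`: the `p`-part of
the `K`-equivariant formula for all `p` — the two-variable main conjecture, its descent and
Kato's explicit reciprocity law), Deuring's `L(E_K/K,s) = L(E/ℚ,s)²` (`hD`, for Shimura 7.42 in
the proof of Cor. 1) and the Deuring–Hecke continuation of `L(E/ℚ,s)` for CM curves (`hH`);
through `BurungaleFlach2024_main_cmField_of_halves` (last sentence of the proof of Thm. 1.1,
p. 22) and `BurungaleFlach2024_bsd_cmField_of_main_of_hecke` (proof of Cor. 1, p. 3); the CM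
period lattice, `h_K = 1`, global minimal models and (periodnorm) being theorems.
[cite: BurungaleFlach2024, Thm. 1.1 and its proof (p. 22), Cor. 1 and its proof (p. 3), Prop. 2.3, Prop. 4.1, Lemma 13] -/
theorem BurungaleFlach2024_bsd_cmField_of_printed_leaves
    (hA : BurungaleFlach2024_finite_primary_cmField) (hB : BurungaleFlach2024_main_cmField_pPart)
    (hD : Deuring_LFunction_baseChange_cmField)
    (hH : hasEntireLFunction_of_j_mem_maximalCMJInvariants) : BurungaleFlach2024_bsd_cmField :=
  BurungaleFlach2024_bsd_cmField_of_main_of_hecke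
    (BurungaleFlach2024_main_cmField_of_halves hA hB) hD hH

/-- **Corollary 1 at `F = K` from the six current terminal leaves of the tree.**
`BurungaleFlach2024_bsd_cmField` follows, sorry-free, from
1. `BurungaleFlach2024_main_cmField_pPart` — Burungale–Flach, Prop. 2.3 with Lemma 13 at `F = K`
   for every rational prime `p` (the paper's contribution: Johnson-Leung–Kings' main conjecture,
   its descent Prop. 4.1, Kato's reciprocity law; for `𝔭 ∤ #𝓞_K^×` also Rubin 1991);
2. `Rubin1987_sha_primary_finite` — Rubin, Invent. Math. 89 (1987), §10;
3. `CoatesWiles1977_L_one_div_period_mem_prime` — Coates–Wiles, Invent. Math. 39 (1977), §6;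
4. `LSeries_baseChange_quadratic` — Artin formalism `L(E_K/K,s) = L(E,s)L(E^{(d_K)},s)`;
5. `WeierstrassCurve.hasseWeilEulerFactor_geomPoints W ℓ` for all elliptic `W/ℚ` and primes `ℓ`
   — the Euler factors of Mathlib's `L`-function are those of the Tate module, whence Knapp 11.67;
6. `hasEntireLFunction_of_j_mem_maximalCMJInvariants` — Deuring–Hecke: `L(E/ℚ,s)` is entire for
   `E` with CM by `𝓞_K` (Silverman *Advanced Topics* Cor. II.10.5.1);
everything else in the printed chain Thm. 1.1 ⇒ Cor. 1 at `F = K` being proved in the tree: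
Mordell–Weil and the finiteness of `E(ℚ)` from 3 (`…_of_pAdicDivisibility`, nine singular
moduli), the CM period lattice `Λ_E = Ω𝓞_K`, the nine twist isogenies `E ∼ E^{(d_K)}`, Deuring
from 4–5 (`Deuring_LFunction_baseChange_cmField_of_artinFormalism`), the quadratic descent of
finiteness, `Ш` and `E(K)` under changes of variables, class number one, global minimal models,
(periodnorm), the local–global passage for fractional `𝓞_K`-ideals and Thm. 1.1 ⇒ Cor. 1.
[cite: BurungaleFlach2024, Thm. 1.1, Cor. 1 and proof of Thm. 1.1 (arXiv pp. 3, 22)] -/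
theorem BurungaleFlach2024_bsd_cmField_of_classical_leaves
    (hB : BurungaleFlach2024_main_cmField_pPart) (hR : Rubin1987_sha_primary_finite)
    (h1 : CoatesWiles1977_L_one_div_period_mem_prime) (hBCL : LSeries_baseChange_quadratic)
    (hHW : ∀ (W : WeierstrassCurve ℚ) [W.IsElliptic] (ℓ : ℕ) [Fact ℓ.Prime],
      W.hasseWeilEulerFactor_geomPoints ℓ)
    (hH : hasEntireLFunction_of_j_mem_maximalCMJInvariants) : BurungaleFlach2024_bsd_cmField :=
  have hKn : LFunction_eq_of_isIsogenous :=
    LFunction_eq_of_isIsogenous_of_hasseWeilEulerFactor_geomPoints hHW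
  have hD : Deuring_LFunction_baseChange_cmField :=
    Deuring_LFunction_baseChange_cmField_of_artinFormalism hBCL
      isIsogenous_quadraticTwist_cmFieldDiscr_holds hKn
  BurungaleFlach2024_bsd_cmField_of_printed_leaves
    (BurungaleFlach2024_finite_primary_cmField_of_classical_of_hecke
      (finite_point_of_j_mem_maximalCMJInvariants_of_L_one_ne_zero_of_pAdicDivisibility h1) hKn hR
      hD hH)
    hB hD hH

/-- Bookkeeping: the same from the modularity leaf `WeierstrassCurve.hasEntireLFunction_rat`
(every `E/ℚ` has an entire `L`-function; Wiles, BCDT), of which the CM continuation is a special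
case — the restriction to Corollary 1 over `K` of
`bsdTriple_of_j_mem_maximalCMJInvariants_of_L_one_ne_zero_of_eleven_leaves`, with the singular
moduli and the twist isogenies now discharged.
[cite: BurungaleFlach2024, Cor. 1 (arXiv p. 3)] [cite: BCDTJAMS2001, Theorem A] -/
theorem BurungaleFlach2024_bsd_cmField_of_classical_leaves_of_modularity
    (hB : BurungaleFlach2024_main_cmField_pPart) (hR : Rubin1987_sha_primary_finite)
    (h1 : CoatesWiles1977_L_one_div_period_mem_prime) (hBCL : LSeries_baseChange_quadratic)
    (hHW : ∀ (W : WeierstrassCurve ℚ) [W.IsElliptic] (ℓ : ℕ) [Fact ℓ.Prime],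
      W.hasseWeilEulerFactor_geomPoints ℓ)
    (hmod : hasEntireLFunction_rat) : BurungaleFlach2024_bsd_cmField :=
  BurungaleFlach2024_bsd_cmField_of_classical_leaves hB hR h1 hBCL hHW
    (hasEntireLFunction_of_j_mem_maximalCMJInvariants_of_hasEntireLFunction_rat hmod)

end Literature.NumberTheory.EllipticCurves

end
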